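import Literature.AnabelianGeometry.EtaleTheta.KummerEquivarianceAction
import Literature.AnabelianGeometry.AbsoluteAnabelian.MonoidKummerModel
import Mathlib.FieldTheory.KrullTopology
import Mathlib.FieldTheory.Galois.Infinite

/-!
# [AbsTopIII] Prop 3.2 (ii) at the MODEL: the Kummer map `𝒪_k̄^▷ → lim→_N H¹(N, Λ(k̄ˣ))` as an
# INJECTIVE, `Π_k`-EQUIVARIANT monoid homomorphism into a GROUP with `Π_k`-ACTION
# (abc-iut cell; GAP-LEDGER G-w4d019-1, equivariance half; cross-layer L2/L4 ↔ L6)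

S. Mochizuki, *Topics in absolute anabelian geometry III*, §3, Definition 3.1 (i) p. 66 (the model
`TM`-pair `(Π_k ↷ 𝒪_k̄^▷)`, `ε_k : Π_k ↠ G_k = Gal(k̄/k)`) and Proposition 3.2 (ii) p. 71 ("the Kummer maps
`M^H_TM → H¹(H, μ_Ẑ(M_TM))`, `M_TM → lim→_J H¹(J, μ_Ẑ(M_TM))`"); bib key `MochizukiAbsTopIII2015`.  CONSUMER:
[IUTchII] Example 1.8 (ii) and Proposition 3.1 (ii) p. 88 — the constant monoid "`Ψ_cns(M^Θ_*) := M_TM(M^Θ_*)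
⊆ lim_J H¹(Π_Ÿ(M^Θ_*)|_J, Π_μ(M^Θ_*))` … naturally isomorphic to `O^▷_{F̄_v}` … equipped with a natural
conjugation action by `Π_X(M^Θ_*)`", typed by abc-iut-L6-t2 as `TemperedThetaMonoids.ThetaEnvData`
(`H : CommGrpCat`, `conj : Π →* MulAut H`, `constants : Submonoid H`) and reduced by the proof companions
`TemperedThetaMonoidsProofs2.lean` (p411791 / p411800) to: an INJECTIVE, `Π`-EQUIVARIANT monoid
homomorphism `κ : O →* H` with `constants = mrange κ` — GAP-LEDGER row G-w4d019-1.

THIS FILE constructs that triple `(H, conj, κ)` for the MODEL, entirely out of landed REAL objects (L2's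
`EtaleTheta.kummerMap` / `H1Colimit` / `conjColimMap` over Mathlib `groupCohomology.H1`, LANA §6.1; L4-t2's
`MLFClosure` / `ModelMLFGaloisData` / `nonzeroIntegers` / `toUnit`; the action laws of
`KummerEquivarianceAction.lean`):

* the SYSTEM `ModelMLFGaloisData.galNormalSystem D : GalNormalIdx C → Subgroup Π_k` of the PREIMAGES under
  `ε_k` of the OPEN NORMAL subgroups of `G_k` — open normal subgroups of `Π_k` (no openness hypothesis on
  `ε_k` is needed anywhere below, unlike the all-open-subgroups packaging of `MonoidKummerModelProofs`),
  directed by `⊓`, nonempty;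
* `isExhausted_units` — hypothesis (c) of LANA §6.1 for `A = k̄ˣ`: every unit of `k̄` is fixed by some member
  of the system (the fixing subgroup of the normal closure of `k(a)`, finite and normal over `k`, is open —
  Krull topology — and normal — kernel of `restrictNormalHom`);
* `cohLim C D := Multiplicative (lim→_N H¹(ε_k⁻¹ N, Λ(k̄ˣ)))` — the ambient module as a multiplicatively
  written commutative GROUP — with the `Π_k`-ACTION `cohLimConj : Π_k →* MulAut (cohLim C D)`
  (`CoMorphism.conjColimMulAut`);
* `constantsKummerHom : 𝒪_k̄^▷ →* cohLim C D` — the Kummer map of the monoid of non-zero integers as a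
  MONOID HOMOMORPHISM (`kummerMap_mul`), `Π_k`-EQUIVARIANT (`constantsKummerHom_smul`, from
  `conjColimMap_kummerMap`) and INJECTIVE (`constantsKummerHom_injective`: at each level the invariants
  lie in a finite extension `k'` of `k`, where `⋂ₙ (k'^×)ⁿ = 1` — abc-iut-L4's
  `MLFClosure.eq_one_of_forall_pos_exists_pow_eq`);
* hence `exists_mulEquiv_mrange_constantsKummerHom` — `𝒪_k̄^▷ ≃*` the "monoid of constants"
  `Ψ_cns := mrange κ`, and `mrange_constantsKummerHom_stable` — `Ψ_cns` is stable under the `Π_k`-action: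
  the two printed clauses of [IUTchII] Prop. 3.1 (ii) at the model, in a genuine group with a genuine action.

INDEX SET (honest reading).  Print's "`lim_J`" runs over ALL finite-index open subgroups `J ⊆ Π`
([IUTchII] Cor. 1.12 (a) p. 56); the system used here — preimages `ε_k⁻¹(N)` of the open normal `N ⊆ G_k` —
consists of finite-index open NORMAL subgroups of `Π_k` (normality is what the conjugation action on the
colimit needs, `KummerEquivariance.lean`), a sub-system of print's index set; the structure maps give the
canonical homomorphism from this colimit to any colimit over a larger directed index set, and the classes of
CONSTANTS (Kummer classes of elements of `k̄`) all arise at these levels (`isExhausted_units`); no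
cofinality claim about print's full index set is made or used here.

NOT here (recorded, the last piece of G-w4d019-1): the change of coefficients `Λ(k̄ˣ) = μ_Ẑ(G_v) ⥲ Π_μ(M^Θ_*)`
along the cyclotomic rigidity isomorphisms ([IUTchII] Cor. 1.11 (a) / 2.9 / 2.8 (i); abc-iut-L6-t1) — an
isomorphism of coefficient modules, along which everything here transports.  HONEST FRAMING: OUR kernel
construction of classical Kummer theory as used by a refereed paper; nothing here bears on [IUTchIII]
Cor. 3.12; typed ≠ proved.
-/

noncomputable section

namespace Literature.AnabelianGeometry.AbsoluteAnabelian

open Literature.AnabelianGeometry.EtaleTheta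

variable (C : MLFClosure.{0}) (D : ModelMLFGaloisData C.k C.K)

namespace ModelMLFGaloisData

/-! ### The system of preimages of open normal subgroups of `G_k` -/

/-- The index poset: OPEN NORMAL subgroups of `G_k = Gal(k̄/k)` under REVERSE inclusion.
[cite: MochizukiAbsTopIII2015, Proposition 3.2 (ii) p.71] -/
abbrev GalNormalIdx : Type :=
  {N : Subgroup (C.K ≃ₐ[C.k] C.K) // N.Normal ∧ IsOpen (N : Set (C.K ≃ₐ[C.k] C.K))}ᵒᵈ

/-- Equality of indices is decided classically (required by `AddCommGroup.DirectLimit`).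
[cite: MochizukiAbsTopIII2015, Proposition 3.2 (ii) p.71] -/
noncomputable instance GalNormalIdx.instDecidableEq : DecidableEq (GalNormalIdx C) := Classical.decEq _

/-- The open normal subgroup of `G_k` underlying an index. [cite: MochizukiAbsTopIII2015, Proposition 3.2 (ii) p.71] -/
abbrev GalNormalIdx.N (i : GalNormalIdx C) : Subgroup (C.K ≃ₐ[C.k] C.K) := (OrderDual.ofDual i).1

/-- `i ≤ j` means `N_j ⊆ N_i`. [cite: MochizukiAbsTopIII2015, Proposition 3.2 (ii) p.71] -/
theorem GalNormalIdx.le_iff {i j : GalNormalIdx C} : i ≤ j ↔ j.N ≤ i.N := Iff.rfl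

/-- The whole group is an index (the poset is nonempty). [cite: MochizukiAbsTopIII2015, Proposition 3.2 (ii) p.71] -/
instance GalNormalIdx.instNonempty : Nonempty (GalNormalIdx C) :=
  ⟨OrderDual.toDual ⟨⊤, inferInstance, isOpen_univ⟩⟩

/-- The index poset is directed: `N ⊓ N'` is again open and normal.
[cite: MochizukiAbsTopIII2015, Proposition 3.2 (ii) p.71] -/
instance GalNormalIdx.isDirected : IsDirectedOrder (GalNormalIdx C) := by
  refine ⟨fun i j => ?_⟩
  haveI := (OrderDual.ofDual i).2.1
  haveI := (OrderDual.ofDual j).2.1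
  refine ⟨OrderDual.toDual ⟨i.N ⊓ j.N, inferInstance,
    (OrderDual.ofDual i).2.2.inter (OrderDual.ofDual j).2.2⟩, ?_, ?_⟩
  · exact (inf_le_left : i.N ⊓ j.N ≤ i.N)
  · exact (inf_le_right : i.N ⊓ j.N ≤ j.N)

/-- **The system**: `i ↦ ε_k⁻¹(N_i) ⊆ Π_k`, the preimages of the open normal subgroups of `G_k`.
[cite: MochizukiAbsTopIII2015, Proposition 3.2 (ii) p.71] -/
def galNormalSystem (i : GalNormalIdx C) : Subgroup D.Pi := (GalNormalIdx.N C i).comap D.aug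

/-- The system is antitone (restriction maps go along `i ≤ j`). [cite: MochizukiAbsTopIII2015, Proposition 3.2 (ii) p.71] -/
theorem galNormalSystem_anti : ∀ ⦃i j : GalNormalIdx C⦄, i ≤ j → D.galNormalSystem C j ≤ D.galNormalSystem C i :=
  fun _ _ h => Subgroup.comap_mono h

/-- Each member `ε_k⁻¹(N)` is NORMAL in `Π_k`. [cite: MochizukiAbsTopIII2015, Proposition 3.2 (ii) p.71] -/
instance galNormalSystem_normal (i : GalNormalIdx C) : (D.galNormalSystem C i).Normal := by
  haveI := (OrderDual.ofDual i).2.1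
  exact Subgroup.Normal.comap inferInstance D.aug

/-- Each member `ε_k⁻¹(N)` is OPEN in `Π_k` (`ε_k` continuous). [cite: MochizukiAbsTopIII2015, Proposition 3.2 (ii) p.71] -/
theorem isOpen_galNormalSystem (i : GalNormalIdx C) : IsOpen (D.galNormalSystem C i : Set D.Pi) :=
  (OrderDual.ofDual i).2.2.preimage D.continuous_aug

/-- Membership: `g ∈ ε_k⁻¹(N_i) ↔ ε_k(g) ∈ N_i`. [cite: MochizukiAbsTopIII2015, Proposition 3.2 (ii) p.71] -/
theorem mem_galNormalSystem_iff (i : GalNormalIdx C) (g : D.Pi) :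
    g ∈ D.galNormalSystem C i ↔ D.aug g ∈ GalNormalIdx.N C i := Iff.rfl

/-! ### Exhaustion: every unit of `k̄` is fixed by some member of the system -/

/-- For `a ∈ k̄`, the fixing subgroup of the normal closure of `k(a)` in `k̄`: an OPEN NORMAL subgroup of
`G_k` fixing `a`. [cite: MochizukiAbsTopIII2015, Definition 3.1 (i) p.66] -/
theorem exists_openNormal_fixing (a : C.K) :
    ∃ i : GalNormalIdx C, ∀ σ ∈ GalNormalIdx.N C i, σ a = a := by
  haveI : Algebra.IsAlgebraic C.k C.K := inferInstance
  -- the finite extension `k(a)` and its normal closure `E`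
  set k' : IntermediateField C.k C.K := IntermediateField.adjoin C.k {a} with hk'
  haveI : FiniteDimensional C.k k' :=
    IntermediateField.adjoin.finiteDimensional (Algebra.IsAlgebraic.isAlgebraic a).isIntegral
  set E : IntermediateField C.k C.K := IntermediateField.normalClosure C.k k' C.K with hE
  haveI : FiniteDimensional C.k E := normalClosure.is_finiteDimensional C.k k' C.K
  haveI : Normal C.k E := normalClosure.normal C.k k' C.K
  have hN : E.fixingSubgroup.Normal := by
    rw [← IntermediateField.restrictNormalHom_ker E]
    exact MonoidHom.normal_ker _
  refine ⟨OrderDual.toDual ⟨E.fixingSubgroup, hN, E.fixingSubgroup_isOpen⟩, fun σ hσ => ?_⟩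
  have hak' : a ∈ k' := IntermediateField.subset_adjoin C.k {a} (Set.mem_singleton a)
  have haE : a ∈ E := IntermediateField.le_normalClosure k' hak'
  exact (IntermediateField.mem_fixingSubgroup_iff _ _).mp hσ a haE

/-- **Hypothesis (c) of LANA §6.1 for `A = k̄ˣ` with the system of preimages of open normal subgroups**:
every unit of `k̄` is invariant under some member of the system. [cite: LANA2026Report, §6.1 p.31] -/
theorem isExhausted_units : IsExhausted (G := D.Pi) (C.K)ˣ (D.galNormalSystem C) := by
  intro u
  obtain ⟨i, hi⟩ := exists_openNormal_fixing C (u : C.K)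
  refine ⟨i, fun g => Units.ext ?_⟩
  change ((((g : D.galNormalSystem C i) : D.Pi) • u : (C.K)ˣ) : C.K) = u
  rw [D.units_coe_smul]
  exact hi _ ((D.mem_galNormalSystem_iff C i g).mp g.2)

/-! ### The ambient group with `Π_k`-action and the Kummer homomorphism of `𝒪_k̄^▷` -/

/-- The additively written colimit `lim→_N H¹(ε_k⁻¹ N, Λ(k̄ˣ))` over the system (L2's `H1Colimit`).
[cite: MochizukiAbsTopIII2015, Proposition 3.2 (ii) p.71] -/
abbrev cohColim : Type := H1Colimit (G := D.Pi) (C.K)ˣ (D.galNormalSystem C) (D.galNormalSystem_anti C)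

/-- **The ambient module** `lim→_N H¹(ε_k⁻¹ N, Λ(k̄ˣ))`, written MULTIPLICATIVELY — a commutative group (the
`H` of [IUTchII] Prop. 3.1's "`⊆ lim_J H¹(Π_Ÿ(M^Θ_*)|_J, Π_μ(M^Θ_*))`" at the model, before the change of
coefficient cyclotome). [cite: MochizukiAbsTopIII2015, Proposition 3.2 (ii) p.71] -/
abbrev cohLim : Type := Multiplicative (cohColim C D)

/-- **The natural conjugation action of `Π_k`** on the ambient module, `Π_k →* MulAut (cohLim C D)`
(`CoMorphism.conjColimMulAut`; the members of the system are normal in `Π_k`).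
[cite: MochizukiAbsTopIII2015, Proposition 3.2 (ii) p.71] -/
def cohLimConj : D.Pi →* MulAut (cohLim C D) :=
  CoMorphism.conjColimMulAut (G := D.Pi) (A := (C.K)ˣ) (D.galNormalSystem C) (D.galNormalSystem_anti C)

/-- The Kummer map of `k̄ˣ` into the colimit (L2's `kummerMap` for the exhausted system), additively.
[cite: MochizukiAbsTopIII2015, Proposition 3.2 (ii) p.71] -/
def unitsKummer (u : (C.K)ˣ) : cohColim C D :=
  kummerMap (D.galNormalSystem_anti C) (D.isExhausted_units C) u

/-- **The Kummer map of the monoid of non-zero integers `𝒪_k̄^▷` as a MONOID HOMOMORPHISM** into the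
multiplicatively written colimit: `m ↦ κ(m)` ("the Kummer maps `M_TM → lim→_J H¹(J, μ_Ẑ(M_TM))`").
[cite: MochizukiAbsTopIII2015, Proposition 3.2 (ii) p.71] -/
def constantsKummerHom : nonzeroIntegers C.k C.K →* cohLim C D where
  toFun m := Multiplicative.ofAdd (D.unitsKummer C (toUnit m))
  map_one' := by
    change Multiplicative.ofAdd (kummerMap _ _ (toUnit (1 : nonzeroIntegers C.k C.K))) = 1
    have h1 : toUnit (1 : nonzeroIntegers C.k C.K) = 1 := Units.ext rfl
    rw [h1, kummerMap_one]
    rfl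
  map_mul' m m' := by
    change Multiplicative.ofAdd (kummerMap _ _ (toUnit (m * m'))) =
      Multiplicative.ofAdd (kummerMap _ _ (toUnit m)) * Multiplicative.ofAdd (kummerMap _ _ (toUnit m'))
    rw [toUnit_mul, kummerMap_mul, ofAdd_add]

/-- `constantsKummerHom` on elements. [cite: MochizukiAbsTopIII2015, Proposition 3.2 (ii) p.71] -/
theorem constantsKummerHom_apply (m : nonzeroIntegers C.k C.K) :
    D.constantsKummerHom C m = Multiplicative.ofAdd (D.unitsKummer C (toUnit m)) := rfl

/-- **`Π_k`-EQUIVARIANCE of the Kummer homomorphism**: `κ(g • m) = g ⋆ κ(m)` for the conjugation action on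
the ambient module ("This map is `G`-equivariant with respect to the natural action of `G` on `H¹`", LANA
§6.1; "equipped with a natural conjugation action", [IUTchII] Prop. 3.1 (ii)).
[cite: MochizukiAbsTopIII2015, Proposition 3.2 (ii) p.71] -/
theorem constantsKummerHom_smul (g : D.Pi) (m : nonzeroIntegers C.k C.K) :
    D.constantsKummerHom C (g • m) = D.cohLimConj C g (D.constantsKummerHom C m) := by
  rw [constantsKummerHom_apply, constantsKummerHom_apply, ← D.smul_toUnit, cohLimConj, unitsKummer,
    unitsKummer, CoMorphism.conjColimMulAut_ofAdd_kummerMap]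

/-! ### Injectivity (Kummer-faithfulness of MLF's, level by level) -/

/-- At a member `ε_k⁻¹(N)` of the system, an invariant unit of `k̄` all of whose `n`-th roots (`n ≥ 1`) can
be chosen invariant is `1`: the invariants lie in a finite extension `k'` of `k` (`N` is open, Krull
topology + infinite Galois correspondence), where `⋂ₙ (k'^×)ⁿ = 1` (abc-iut-L4
`MLFClosure.eq_one_of_forall_pos_exists_pow_eq`). [cite: MochizukiAbsTopIII2015, Rmk 1.5.4 (i) p.33] -/
theorem eq_one_of_invariant_roots (i : GalNormalIdx C) (a : (C.K)ˣ)
    (ha : a ∈ invariants (A := (C.K)ˣ) (D.galNormalSystem C i))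
    (hroots : ∀ n : ℕ+, ∃ b ∈ invariants (A := (C.K)ˣ) (D.galNormalSystem C i), b ^ (n : ℕ) = a) :
    a = 1 := by
  -- a finite level `E` whose fixing subgroup lies inside the open `N_i`
  have h1 : ((GalNormalIdx.N C i : Subgroup (C.K ≃ₐ[C.k] C.K)) : Set (C.K ≃ₐ[C.k] C.K)) ∈
      nhds (1 : C.K ≃ₐ[C.k] C.K) := (OrderDual.ofDual i).2.2.mem_nhds (Subgroup.one_mem _)
  obtain ⟨E, hEfin, hEsub⟩ := (krullTopology_mem_nhds_one_iff C.k C.K _).mp h1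
  haveI : FiniteDimensional C.k E := hEfin
  -- an invariant unit lies in `E`
  have hmemE : ∀ b : (C.K)ˣ, b ∈ invariants (A := (C.K)ˣ) (D.galNormalSystem C i) → ((b : C.K) ∈ E) := by
    intro b hb
    rw [← InfiniteGalois.fixedField_fixingSubgroup E, IntermediateField.mem_fixedField_iff]
    intro σ hσ
    obtain ⟨g, rfl⟩ := D.aug_surjective σ
    have hg : g ∈ D.galNormalSystem C i := (D.mem_galNormalSystem_iff C i g).mpr (hEsub hσ)
    have hb' : g • b = b := hb ⟨g, hg⟩
    have := congrArg (fun u : (C.K)ˣ => (u : C.K)) hb'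
    simpa [AlgEquiv.smul_def] using this
  have ha1 : ((a : (C.K)ˣ) : C.K) = 1 := by
    refine MLFClosure.eq_one_of_forall_pos_exists_pow_eq C E (hmemE a ha) a.ne_zero fun n hn => ?_
    obtain ⟨b, hb, hba⟩ := hroots ⟨n, hn⟩
    refine ⟨(b : C.K), hmemE b hb, ?_⟩
    have := congrArg (fun u : (C.K)ˣ => (u : C.K)) hba
    simpa [Units.val_pow_eq_pow_val] using this
  exact Units.ext ha1

/-- **The Kummer map of `k̄ˣ` into the colimit is injective** (as an additive homomorphism out of
`Additive k̄ˣ`). [cite: MochizukiAbsTopIII2015, Proposition 3.2 (ii) p.71] -/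
theorem unitsKummerHom_injective :
    Function.Injective (kummerMapHom (D.galNormalSystem_anti C) (D.isExhausted_units C)) :=
  kummerMapHom_injective_of (D.galNormalSystem C) (D.galNormalSystem_anti C) (D.isExhausted_units C)
    fun i a ha hroots => D.eq_one_of_invariant_roots C i a ha hroots

/-- `unitsKummer` is injective on `k̄ˣ`. [cite: MochizukiAbsTopIII2015, Proposition 3.2 (ii) p.71] -/
theorem unitsKummer_injective : Function.Injective (D.unitsKummer C) := fun u v h =>
  Additive.ofMul.injective (D.unitsKummerHom_injective C (a₁ := Additive.ofMul u) (a₂ := Additive.ofMul v) h)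

/-- **INJECTIVITY of the Kummer homomorphism of `𝒪_k̄^▷`** (no hypothesis on `ε_k`).
[cite: MochizukiAbsTopIII2015, Proposition 3.2 (ii) p.71] -/
theorem constantsKummerHom_injective : Function.Injective (D.constantsKummerHom C) := by
  intro m m' h
  have h' : D.unitsKummer C (toUnit m) = D.unitsKummer C (toUnit m') := Multiplicative.ofAdd.injective h
  exact toUnit_injective (D.unitsKummer_injective C h')

/-! ### [IUTchII] Prop 3.1 (ii) at the model: `Ψ_cns := mrange κ ≅ 𝒪_k̄^▷`, stable under `Π_k` -/

/-- **"A 'monoid of constants' … naturally isomorphic to `O^▷_{F̄_v}`"** at the model: `𝒪_k̄^▷ ≃*` the image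
submonoid `Ψ_cns := mrange κ` of the Kummer homomorphism inside the ambient group, the isomorphism being `κ`
on elements. [cite: MochizukiAbsTopIII2015, Proposition 3.2 (ii) p.71] -/
theorem exists_mulEquiv_mrange_constantsKummerHom :
    ∃ e : nonzeroIntegers C.k C.K ≃* MonoidHom.mrange (D.constantsKummerHom C),
      ∀ m, ((e m : MonoidHom.mrange (D.constantsKummerHom C)) : cohLim C D) = D.constantsKummerHom C m :=
  ⟨MulEquiv.ofBijective (D.constantsKummerHom C).mrangeRestrict
      ⟨fun _ _ e => D.constantsKummerHom_injective C (congrArg Subtype.val e),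
        (D.constantsKummerHom C).mrangeRestrict_surjective⟩,
    fun _ => rfl⟩

/-- **"… equipped with a natural conjugation action by `Π_X(M^Θ_*)`"** at the model: the image submonoid
`Ψ_cns = mrange κ` is STABLE under the `Π_k`-action on the ambient module (equivariance of `κ` + stability of
`𝒪_k̄^▷` under `Π_k`). [cite: MochizukiAbsTopIII2015, Proposition 3.2 (ii) p.71] -/
theorem mrange_constantsKummerHom_stable (g : D.Pi) (y : cohLim C D)
    (hy : y ∈ MonoidHom.mrange (D.constantsKummerHom C)) :
    D.cohLimConj C g y ∈ MonoidHom.mrange (D.constantsKummerHom C) := by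
  obtain ⟨m, rfl⟩ := hy
  exact ⟨g • m, D.constantsKummerHom_smul C g m⟩

end ModelMLFGaloisData

end Literature.AnabelianGeometry.AbsoluteAnabelian

end
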